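import Mathlib
import HarnessLib
import Literature.Analysis.FluidPDE.QuantitativeShellsOfRegularity
import Literature.Analysis.FluidPDE.LocalTypeI
import Literature.Analysis.FluidPDE.SereginSverakAxisymmetric
import Literature.Analysis.FluidPDE.AxisymmetricEuler
import Summits.NavierStokesRegularity.NavierStokesRegularity.Theorems.AxisTwistDoorAveragedConeLiouvilleDefs

/-!
# Crux `AxisTwistDoor.AveragedConeLiouville` (stmt-NavierStokesRegularity-26889), line `lrt_shell` (LEAD ns-atd-p1 g0): brick C5 —
# THE BOOKKEEPING HALF OF THE BRIDGE `stub_shellOfLeiRen : LeiRen2024_quantitative_regular_shells_cyl → ShellFact`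

The bridge from the typed Lei–Ren fact (flat cylinders, `Literature.Analysis.FluidPDE.LeiRen2024_quantitative_regular_shells_cyl`)
to the class-specialised `ShellFact` of the line has an ANALYTIC CORE — the class profile restricted to `𝓠(1)`, with a normalised
pressure `π′`, is a local suitable weak solution in the flat cylinder with `∫_{𝓠(1)}(|v|³ + |π′|^{3/2}) + 2 ≤ G₀(𝐈)` (critic L1) — and a
BOOKKEEPING SHELL around it.  This file proves the shell: `shellFact_of_leiRen_of_core` takes the Lei–Ren fact and the core (as a
hypothesis, binder `hcore`) and returns `ShellFact` — a uniform `G₀` gives the uniform `δ₀ := G₀^{−MG₀}` and `B := G₀^{MG₀}`, the printed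
`a < 3/4` gives `a < 4/5`, the points `(t, cylPt r θ z)` with `a−δ < r < a+δ`, `|z| < a+δ`, `−(a+δ)² < t < 0` lie in the OPEN lateral shell
`𝓠(a+δ) ∖ cl 𝓠(a−δ)`, the continuous class profile (`InClass.cont`) coincides with the regular-shell representative there
(`MeasureTheory.Measure.eqOn_open_of_ae_eq`), hence so do the spatial derivatives on the open slices, and the printed bound
`‖w‖ + ‖∇w‖ + ‖∇²w‖ ≤ B` gives `‖v‖, ‖∇v‖ ≤ B`.  The analytic core itself is ns-in-wu-341 g2's `…ShellCore.shellCore_of_class` (same binder text).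

WHAT THIS IS NOT: not NS regularity, not the crux, not the bridge's analytic core — a helper `--supports stmt-NavierStokesRegularity-26889
--as helper` (width seat ns-cas-k2 g0); ACL 26889 and NS regularity are OPEN.
[cite: LeiRenTian2025, Lemma 2.4 with Remark 2.1 and §4 (4.8) (arXiv:2501.08976, pp. 6–7, 11)]
-/

noncomputable section

set_option linter.dupNamespace false

namespace Summit.NavierStokesRegularity.NavierStokesRegularity.Theorems.AveragedConeLiouville.ShellBookkeeping

open scoped Topology ENNReal NNReal
open Set Function MeasureTheory Metric
open Literature.Analysis Literature.Analysis.FluidPDE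
open Summit.NavierStokesRegularity.NavierStokesRegularity.Theorems.AxisTwistDoorAveragedConeLiouvilleDefs

/-- Components of `cylPt r θ z = (r cos θ, r sin θ, z)`. [folklore] -/
theorem cylPt_apply (r θ z : ℝ) :
    cylPt r θ z 0 = r * Real.cos θ ∧ cylPt r θ z 1 = r * Real.sin θ ∧ cylPt r θ z 2 = z := by
  simp [cylPt]

/-- `cylRadius (cylPt r θ z) = r` for `r ≥ 0`. [folklore] -/
theorem cylRadius_cylPt {r : ℝ} (hr : 0 ≤ r) (θ z : ℝ) : cylRadius (cylPt r θ z) = r := by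
  obtain ⟨h0, h1, -⟩ := cylPt_apply r θ z
  rw [cylRadius, h0, h1, show (r * Real.cos θ) ^ 2 + (r * Real.sin θ) ^ 2 = r ^ 2 by
    nlinarith [Real.cos_sq_add_sin_sq θ], Real.sqrt_sq hr]

/-- The closure of the flat cylinder `𝓠(ρ)` (centred at the origin) lies in `{cylRadius ≤ ρ}`. [folklore] -/
theorem closure_parCyl_subset (ρ : ℝ) :
    closure (SereginSverak2009.parCyl (0 : ℝ × EuclideanSpace ℝ (Fin 3)) ρ) ⊆ {z | cylRadius z.2 ≤ ρ} := by
  refine closure_minimal (fun z hz => ?_) (isClosed_le (continuous_cylRadius.comp continuous_snd) continuous_const)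
  have h := (SereginSverak2009.mem_spaceCyl.1 hz.2).1
  simp only [Prod.snd_zero, sub_zero] at h
  exact h.le

/-- **Shell geometry**: for `a − δ < r < a + δ`, `|z| < a + δ`, `−(a+δ)² < t < 0` (and `0 ≤ a − δ`) the point `(t, cylPt r θ z)`
lies in the open lateral shell `𝓠(a+δ) ∖ cl 𝓠(a−δ)`. [folklore] -/
theorem mem_shell {a δ t r θ z : ℝ} (had : 0 ≤ a - δ) (ht : -(a + δ) ^ 2 < t) (ht0 : t < 0) (hr : a - δ < r)
    (hr' : r < a + δ) (hz : |z| < a + δ) :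
    (t, cylPt r θ z) ∈ SereginSverak2009.parCyl (0 : ℝ × EuclideanSpace ℝ (Fin 3)) (a + δ) \
      closure (SereginSverak2009.parCyl (0 : ℝ × EuclideanSpace ℝ (Fin 3)) (a - δ)) := by
  have hr0 : 0 ≤ r := had.trans hr.le
  have hrad : cylRadius (cylPt r θ z) = r := cylRadius_cylPt hr0 θ z
  refine ⟨⟨?_, ?_⟩, fun h => ?_⟩
  · simp only [Prod.fst_zero, zero_sub]
    exact ⟨by linarith, ht0⟩
  · rw [SereginSverak2009.mem_spaceCyl]
    simp only [Prod.snd_zero, sub_zero, hrad, (cylPt_apply r θ z).2.2, PiLp.zero_apply]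
    exact ⟨hr', hz⟩
  · have := closure_parCyl_subset (a - δ) h
    simp only [mem_setOf_eq, hrad] at this
    linarith

/-- The open lateral shell is open. [folklore] -/
theorem isOpen_shell (ρ₁ ρ₂ : ℝ) :
    IsOpen (SereginSverak2009.parCyl (0 : ℝ × EuclideanSpace ℝ (Fin 3)) ρ₂ \
      closure (SereginSverak2009.parCyl (0 : ℝ × EuclideanSpace ℝ (Fin 3)) ρ₁)) :=
  (SereginSverak2009.isOpen_parCyl _ _).sdiff isClosed_closure

/-- The flat cylinders centred at the origin lie in the lower slab `{t < 0}`. [folklore] -/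
theorem parCyl_subset_slab (ρ : ℝ) :
    SereginSverak2009.parCyl (0 : ℝ × EuclideanSpace ℝ (Fin 3)) ρ ⊆ Set.Iio (0 : ℝ) ×ˢ Set.univ :=
  fun z hz => ⟨by simpa using hz.1.2, mem_univ _⟩

/-- **Identification on the open shell**: a profile continuous on the lower slab agrees EVERYWHERE on an open subset `S` of the slab
with any representative `w` continuous on `S` and a.e. equal to it there; consequently the slices and their derivatives agree.
[folklore] -/
theorem eqOn_of_ae_eq_of_continuousOn {v w : ℝ → EuclideanSpace ℝ (Fin 3) → EuclideanSpace ℝ (Fin 3)}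
    {S : Set (ℝ × EuclideanSpace ℝ (Fin 3))} (hS : IsOpen S) (hSs : S ⊆ Set.Iio (0 : ℝ) ×ˢ Set.univ)
    (hv : ContinuousOn (uncurry v) (Set.Iio (0 : ℝ) ×ˢ Set.univ)) (hw : ContinuousOn (uncurry w) S)
    (hae : uncurry v =ᵐ[volume.restrict S] uncurry w) :
    ∀ z ∈ S, v z.1 z.2 = w z.1 z.2 ∧ fderiv ℝ (v z.1) z.2 = fderiv ℝ (w z.1) z.2 := by
  have heq : EqOn (uncurry v) (uncurry w) S := Measure.eqOn_open_of_ae_eq hae hS (hv.mono hSs) hw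
  intro z hz
  refine ⟨heq hz, Filter.EventuallyEq.fderiv_eq ?_⟩
  have hsl : IsOpen {x : EuclideanSpace ℝ (Fin 3) | (z.1, x) ∈ S} := hS.preimage (Continuous.prodMk_right z.1)
  filter_upwards [hsl.mem_nhds (show z.2 ∈ {x | (z.1, x) ∈ S} from hz)] with x hx
  exact heq hx

/-- **BRICK C5 — `ShellFact` from the Lei–Ren fact, modulo the bridge's analytic core.**  `hcore` is the core: for every
finite Type-I level `I₀` a uniform `G₀ > 0` such that every class profile with `𝐈 ≤ I₀` is, with SOME pressure `π′`, a local
suitable weak solution in the flat unit cylinder `𝓠(1)` with `∫_{𝓠(1)}(|v|³ + |π′|^{3/2}) + 2 ≤ G₀`.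
[cite: LeiRenTian2025, Lemma 2.4 with Remark 2.1 (arXiv:2501.08976, pp. 6–7)] -/
theorem shellFact_of_leiRen_of_core (hLR : LeiRen2024_quantitative_regular_shells_cyl)
    (hcore : ∀ I₀ : ℝ≥0∞, I₀ < ⊤ → ∃ G₀ : ℝ, 0 < G₀ ∧
      ∀ (C : ℝ) (v : ℝ → EuclideanSpace ℝ (Fin 3) → EuclideanSpace ℝ (Fin 3)) (π : ℝ → EuclideanSpace ℝ (Fin 3) → ℝ)
        (H : ℝ → EuclideanSpace ℝ (Fin 3) → EuclideanSpace ℝ (Fin 3) →L[ℝ] EuclideanSpace ℝ (Fin 3)),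
        InClass C v π H → typeIBound (Set.Iio (0 : ℝ) ×ˢ Set.univ) v π H ≤ I₀ →
          ∃ π' : ℝ → EuclideanSpace ℝ (Fin 3) → ℝ, LeiRen2024.IsSuitableWeakSolutionInCyl 1 v π' ∧
            (∫⁻ z in SereginSverak2009.parCyl (0 : ℝ × EuclideanSpace ℝ (Fin 3)) 1,
                (‖v z.1 z.2‖ₑ ^ (3 : ℕ) + ‖π' z.1 z.2‖ₑ ^ (3 / 2 : ℝ))) + 2 ≤ ENNReal.ofReal G₀) :
    ShellFact := by
  obtain ⟨M, hM, hLR⟩ := hLR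
  intro I₀ hI₀
  obtain ⟨G₀, hG₀, hcore⟩ := hcore I₀ hI₀
  refine ⟨G₀ ^ (-(M * G₀)), G₀ ^ (M * G₀), Real.rpow_pos_of_pos hG₀ _, (Real.rpow_pos_of_pos hG₀ _).le, ?_⟩
  intro C v π H hcl hI
  obtain ⟨π', hsuit, hG⟩ := hcore C v π H hcl hI
  obtain ⟨a, δ, ha, ha', hδ, hδ', hshell⟩ := hLR v π' G₀ hsuit hG
  refine ⟨a, δ, ha, by linarith, hδ.le, hδ'.le, fun t ht ht0 r θ z hr hr' hz => ?_⟩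
  obtain ⟨-, w, hwc, -, hae, hwB⟩ := hshell
  have had : 0 ≤ a - δ := by linarith
  have hmem := mem_shell (θ := θ) had ht ht0 hr hr' hz
  obtain ⟨hvw, hDvw⟩ := eqOn_of_ae_eq_of_continuousOn (isOpen_shell _ _) (Set.sdiff_subset.trans (parCyl_subset_slab _))
    hcl.cont hwc hae _ hmem
  have hB := hwB _ hmem
  simp only at hB hvw hDvw
  rw [hvw, hDvw]
  constructor <;> linarith [norm_nonneg (w t (cylPt r θ z)), norm_nonneg (fderiv ℝ (w t) (cylPt r θ z)),
    norm_nonneg (iteratedFDeriv ℝ 2 (w t) (cylPt r θ z))]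

end Summit.NavierStokesRegularity.NavierStokesRegularity.Theorems.AveragedConeLiouville.ShellBookkeeping

end
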